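/-
Copyright: public-domain mathematics; typed transcription for the H21 Literature library (cell lit-balaban,
reader/typer seat r02 gen 5 = literature-prover-lit-balaban-r02-g5-0).

statement-level skeleton of published theorems with citation tags; proofs where landed; nothing here is a claim about the Yang–Mills mass gap

# Bałaban, *Propagators and renormalization transformations for lattice gauge theories. I*,
# Commun. Math. Phys. **95** (1984) 17–40 — the operator `Δ′_a = Δ + aQ′_k*Q′_k` whose inverse is the scalar propagator `G′_k`
# (p. 25, the sentence after (1.42)): b04's stencil `B4Green244.opD` on `ℤ^d`-functions IS the product-torus matrix `LapS + a·Q′*Q′`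
# on `T_η = Π_μ ℤ/(nM_μ)` (the dictionary behind the (1.132) kernel identification: `K_T` of [B2] (2.48) solves the torus equation,
# own memo step (2))

[cite: Balaban1984PropagatorsI]  T. Bałaban, Commun. Math. Phys. 95 (1984) 17–40.  p. 25, text after the integral display (1.42),
verbatim: «with a > 0 (we will take eventually a = 1), and let us denote Δ′_a = Δ + aQ′_k*Q′_k = Δ + aP′_k. The properties of this
operator were investigated in [2], its inverse is a bounded operator G′_k with good regularity properties described in Theorem
of [2].»; p. 20 (1.20) `Q′_k`; p. 21 (1.21) Δ and the weighted scalar products; p. 38 ll. 7–10 (the representation of `P` through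
`G′`).  [cite: Balaban1983RegularityDecay] (2.44) p.584 (the basic equation, `B4Green244.opD`).

v1.1 (r02 gen 6, DOCFIX ONLY — referee ref-1 gen 29 erratum candidate, 2026-08-21T14:41Z): the v1 header paraphrased p. 25 as
«(1.42) G′_k = (Δ + a_kQ′_k*Q′_k)⁻¹ (we will put a = 1 finally)»; in print (1.42) is the INTEGRAL display
`(1.24) = ∫dλ δ(Q′_kλ) exp(−(1/2α)‖∂*A − Δλ − aQ′_k*Q′_kλ‖²)`, the constant is `a` (no subscript k is printed), and `Δ′_a`, `G′_k` are
named in the prose quoted above.  Locators below read «p.25 after (1.42)» accordingly.  No declaration, statement or proof changed.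

WHAT THIS MODULE ADDS (SKELETON row B5.Prop1.2 census (vii), (1.132) kernel identification, memo step (2) «Green uniqueness across
typings», first half = the OPERATOR dictionary): `castZ : ℤ^d → Tor (fine n M)`, `embS f := f ∘ castZ` (periodic extension);
`castZ_add_e`/`castZ_sub_e`; **`negLap_embS`**: `negLap n (embS f) z = (LapS (fine n M) n *ᵥ f) (castZ z)`; `castZ_finePt_coarse` (b04's block
points are own `bpt (blockLabel ·) j`); `QsOp_apply_eq_ite` (`Q′(y,x) = η^d·1[x ∈ Δ(y)]`), `QsAdj_mulVec` (`(Q′*g)(x) = g(⌊x/n⌋)`);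
**`blockAvg_embS`**: `blockAvg n (embS f) z = ((QsAdj * QsOp) *ᵥ f) (castZ z)`; **`opD_embS`**: `opD n a 0 (embS f) = embS ((LapS + a•(QsAdj*QsOp)) *ᵥ f)`.

HONEST SCOPE.  Bookkeeping (index translation); nothing analytic.  Second half (next): `K_T`-sums are `embS` of a torus vector,
`B4TorusGreen244.torusGreen244_apply` read on the torus, injectivity of `LapS + aQ′*Q′` (a > 0) ⇒ `G′Q′* = K_T`.
-/
import Mathlib
import Literature.MathematicalPhysics.QuantumFieldTheory.Balaban1983to89.B4Green244
import Literature.MathematicalPhysics.QuantumFieldTheory.Balaban1983to89.B5Action121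
import Literature.MathematicalPhysics.QuantumFieldTheory.Balaban1983to89.B5Hk160Torus
import Literature.MathematicalPhysics.QuantumFieldTheory.Balaban1983to89.B5Cube1Partition

open scoped BigOperators Matrix ComplexConjugate
open Finset Matrix

namespace Literature.MathematicalPhysics.QuantumFieldTheory.Balaban1983to89.B5GreenBridgeP12Dict

open Literature.MathematicalPhysics.QuantumFieldTheory.Balaban1983to89
open Literature.MathematicalPhysics.QuantumFieldTheory.Balaban1983to89.B5Prop11Plancherel (Tor fine unitVec)
open Literature.MathematicalPhysics.QuantumFieldTheory.Balaban1983to89.B4Green244 (e coarse finePt negLap blockAvg opD)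
open Literature.MathematicalPhysics.QuantumFieldTheory.Balaban1983to89.B5Action121 (LapS LapS_mulVec)
open Literature.MathematicalPhysics.QuantumFieldTheory.Balaban1983to89.B5Block118 (bpt QsOp QsOp_mulVec)
open Literature.MathematicalPhysics.QuantumFieldTheory.Balaban1983to89.B5Blocks16 (bpt_val bpt_eq_natCast digits_lt)
open Literature.MathematicalPhysics.QuantumFieldTheory.Balaban1983to89.B5Hk160Torus (QsAdj)
open Literature.MathematicalPhysics.QuantumFieldTheory.Balaban1983to89.B5Prop12FieldsLattice (cube1)
open Literature.MathematicalPhysics.QuantumFieldTheory.Balaban1983to89.B5Cube1Partition (blockLabel blockLabel_val mem_cube1_iff cube1_eq_image)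

noncomputable section

variable {d : ℕ} (n : ℕ) [NeZero n] (M : Fin d → ℕ) [hM : ∀ μ, NeZero (M μ)]

/-! ## §1 The periodic extension `embS` -/

/-- an integer point read on the fine torus `T_η = Π_μ ℤ/(nM_μ)`. [cite: Balaban1984PropagatorsI, p.18 (the torus T_η)] -/
def castZ (z : Fin d → ℤ) : Tor (fine n M) := fun ν => ((z ν : ℤ) : ZMod (fine n M ν))

/-- the `(nM_μ)_μ`-periodic extension of a torus function to `ℤ^d`. [cite: Balaban1984PropagatorsI, p.18] -/
def embS (f : Tor (fine n M) → ℂ) : (Fin d → ℤ) → ℂ := fun z => f (castZ n M z)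

omit [NeZero n] hM in
/-- `castZ (z + e_μ) = castZ z + e_μ`. [cite: Balaban1984PropagatorsI, (1.31) p.23 (x + ηe_μ)] -/
theorem castZ_add_e (z : Fin d → ℤ) (μ : Fin d) : castZ n M (z + e μ) = castZ n M z + unitVec (fine n M) μ := by
  funext ν
  by_cases h : ν = μ
  · subst h; simp [castZ, e, unitVec]
  · simp [castZ, e, unitVec, Pi.single_eq_of_ne h]

omit [NeZero n] hM in
/-- `castZ (z − e_μ) = castZ z − e_μ`. [cite: Balaban1984PropagatorsI, (1.31) p.23] -/
theorem castZ_sub_e (z : Fin d → ℤ) (μ : Fin d) : castZ n M (z - e μ) = castZ n M z - unitVec (fine n M) μ := by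
  funext ν
  by_cases h : ν = μ
  · subst h; simp [castZ, e, unitVec]
  · simp [castZ, e, unitVec, Pi.single_eq_of_ne h]

/-! ## §2 `−Δ^ξ` is `LapS` -/

omit hM in
/-- **b04's `negLap` is own `LapS` (lattice factor `c = n = η⁻¹`) under the periodic extension.**
[cite: Balaban1984PropagatorsI, (1.21) p.21 (Δ), (1.31) p.23; Balaban1983RegularityDecay (1.3) p.572] -/
theorem negLap_embS [hM : ∀ μ, NeZero (M μ)] (f : Tor (fine n M) → ℂ) (z : Fin d → ℤ) :
    negLap n (embS n M f) z = (LapS (fine n M) (n : ℂ) *ᵥ f) (castZ n M z) := by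
  rw [LapS_mulVec, negLap, Finset.mul_sum]
  refine Finset.sum_congr rfl fun μ _ => ?_
  rw [embS, embS, embS, castZ_add_e, castZ_sub_e, Complex.conj_natCast]
  ring

/-! ## §3 `Q^*Q` is `QsAdj * QsOp` -/

omit hM in
/-- the value of a cast integer coordinate. [folklore] [cite: Balaban1984PropagatorsI, p.18] -/
theorem castZ_val [hM : ∀ μ, NeZero (M μ)] (z : Fin d → ℤ) (ν : Fin d) :
    ((castZ n M z ν).val : ℤ) = z ν % (fine n M ν : ℕ) := by
  unfold castZ
  rw [ZMod.val_intCast]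

omit hM in
/-- **b04's block points are own `bpt`**: `castZ (n·⌊z/n⌋ + j) = bpt (⌊castZ z / n⌋) j`.
[cite: Balaban1984PropagatorsI, (1.6) p.18 (B^k(y)), (1.20) p.20] -/
theorem castZ_finePt_coarse [hM : ∀ μ, NeZero (M μ)] (z : Fin d → ℤ) (j : Fin d → Fin n) :
    castZ n M (finePt n (coarse n z) j) = bpt n M (blockLabel M n (castZ n M z)) j := by
  funext ν
  rw [bpt_eq_natCast, blockLabel_val]
  unfold castZ finePt coarse
  -- both sides are integer casts into `ZMod (nM_ν)`; compare the integers modulo `nM_ν`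
  rw [← Int.cast_natCast (R := ZMod (fine n M ν)) (n * ((((z ν : ℤ) : ZMod (fine n M ν))).val / n) + (j ν : ℕ))]
  refine (ZMod.intCast_eq_intCast_iff' _ _ _).mpr ?_
  have hN : ((fine n M ν : ℕ) : ℤ) = (n : ℤ) * (M ν : ℤ) := by simp [fine]
  have hn0 : (0 : ℤ) < n := by exact_mod_cast Nat.pos_of_ne_zero (NeZero.ne n)
  have hv : (((((z ν : ℤ) : ZMod (fine n M ν))).val : ℕ) : ℤ) = z ν % ((n : ℤ) * (M ν : ℤ)) := by
    rw [ZMod.val_intCast, hN]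
  -- write `z = (nM) q + r`, `r = z mod nM`
  set r : ℤ := z ν % ((n : ℤ) * (M ν : ℤ)) with hr
  have hz : z ν = r + (n : ℤ) * (M ν : ℤ) * (z ν / ((n : ℤ) * (M ν : ℤ))) := (Int.emod_add_mul_ediv _ _).symm
  have hdiv : z ν / (n : ℤ) = (M ν : ℤ) * (z ν / ((n : ℤ) * (M ν : ℤ))) + r / (n : ℤ) := by
    conv_lhs => rw [hz]
    rw [show r + (n : ℤ) * (M ν : ℤ) * (z ν / ((n : ℤ) * (M ν : ℤ))) = r + (n : ℤ) * ((M ν : ℤ) * (z ν / ((n : ℤ) * (M ν : ℤ)))) by ring,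
      Int.add_mul_ediv_left _ _ hn0.ne']
    ring
  push_cast
  rw [hv, hdiv]
  -- `n (M q' + r/n) + j ≡ n (r/n) + j  (mod nM)`
  have : (n : ℤ) * ((M ν : ℤ) * (z ν / ((n : ℤ) * (M ν : ℤ))) + r / (n : ℤ)) + ((j ν : ℕ) : ℤ)
      = ((n : ℤ) * (r / (n : ℤ)) + ((j ν : ℕ) : ℤ)) + ((n : ℤ) * (M ν : ℤ)) * (z ν / ((n : ℤ) * (M ν : ℤ))) := by ring
  rw [this, Int.add_mul_emod_self_left]

omit hM in
/-- **the entries of `Q′`**: `Q′(y, x) = η^d · 1[x ∈ Δ(y)]`. [cite: Balaban1984PropagatorsI, (1.20) p.20] -/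
theorem QsOp_apply_eq_ite [hM : ∀ μ, NeZero (M μ)] (y : Tor M) (x : Tor (fine n M)) :
    QsOp n M y x = if x ∈ cube1 n M y then 1 / (n : ℂ) ^ d else 0 := by
  unfold QsOp
  by_cases hx : x ∈ cube1 n M y
  · rw [if_pos hx]
    have hx' := hx
    rw [cube1_eq_image, Finset.mem_image] at hx'
    obtain ⟨j, -, hj⟩ := hx'
    have hjb : bpt n M y j = x := by
      rw [← hj]; funext ν; rw [bpt_eq_natCast]
    rw [Finset.sum_eq_single j]
    · rw [if_pos hjb.symm]
    · intro j' _ hj'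
      rw [if_neg]
      intro h
      apply hj'
      have hinj := B5Blocks16.bpt_injective n M (a₁ := (y, j')) (a₂ := (y, j)) (by simp [h, hjb])
      simpa using hinj
    · simp
  · rw [if_neg hx]
    refine Finset.sum_eq_zero fun j _ => ?_
    rw [if_neg]
    intro h
    apply hx
    rw [cube1_eq_image, Finset.mem_image]
    refine ⟨j, Finset.mem_univ _, ?_⟩
    rw [h]; funext ν; rw [bpt_eq_natCast]

omit hM in
/-- **`(Q′*g)(x) = g(⌊x/n⌋)`** (the weighted adjoint (1.21)). [cite: Balaban1984PropagatorsI, (1.20)–(1.21) pp.20–21] -/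
theorem QsAdj_mulVec [hM : ∀ μ, NeZero (M μ)] (g : Tor M → ℂ) (x : Tor (fine n M)) :
    (QsAdj n M *ᵥ g) x = g (blockLabel M n x) := by
  have hn : ((n : ℂ) ^ d) ≠ 0 := pow_ne_zero _ (Nat.cast_ne_zero.mpr (NeZero.ne n))
  rw [QsAdj, Matrix.smul_mulVec, Pi.smul_apply, Matrix.mulVec, dotProduct, smul_eq_mul]
  have h : ∀ y, (QsOp n M)ᴴ x y * g y = if blockLabel M n x = y then 1 / (n : ℂ) ^ d * g y else 0 := by
    intro y
    rw [Matrix.conjTranspose_apply]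
    have hq := QsOp_apply_eq_ite n M y x
    by_cases hx : x ∈ cube1 n M y
    · rw [if_pos hx] at hq
      rw [hq, if_pos ((mem_cube1_iff M n x y).mp hx), star_div₀, star_one, star_pow, Complex.star_def, Complex.conj_natCast]
    · rw [if_neg hx] at hq
      rw [hq, if_neg (fun h => hx ((mem_cube1_iff M n x y).mpr h)), star_zero, zero_mul]
  simp_rw [h]
  rw [Finset.sum_ite_eq Finset.univ (blockLabel M n x), if_pos (Finset.mem_univ _)]
  field_simp

omit hM in
/-- **b04's `blockAvg` (`Q^*Q`) is own `QsAdj * QsOp` under the periodic extension.**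
[cite: Balaban1984PropagatorsI, (1.20)–(1.21) pp.20–21; Balaban1983RegularityDecay (1.4)–(1.5) p.572] -/
theorem blockAvg_embS [hM : ∀ μ, NeZero (M μ)] (f : Tor (fine n M) → ℂ) (z : Fin d → ℤ) :
    blockAvg n (embS n M f) z = ((QsAdj n M * QsOp n M) *ᵥ f) (castZ n M z) := by
  rw [← Matrix.mulVec_mulVec, QsAdj_mulVec, QsOp_mulVec, blockAvg, one_div]
  congr 1
  refine Finset.sum_congr rfl fun j _ => ?_
  rw [embS, castZ_finePt_coarse]

/-! ## §4 The operator of (2.44) = `Δ′_a` of p. 25 (text after (1.42)) -/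

omit hM in
/-- **`opD n a 0 (embS f) = embS ((LapS + a•Q′*Q′) f)`**: b04's stencil of the basic equation at `m² = 0` is Bałaban's
`Δ′_a = Δ + aQ′_k*Q′_k` (whose inverse is `G′_k`) on the torus. [cite: Balaban1984PropagatorsI, p.25 text after (1.42); Balaban1983RegularityDecay (2.44) p.584] -/
theorem opD_embS [hM : ∀ μ, NeZero (M μ)] (a : ℝ) (f : Tor (fine n M) → ℂ) (z : Fin d → ℤ) :
    opD n a 0 (embS n M f) z
      = embS n M ((LapS (fine n M) (n : ℂ) + (a : ℂ) • (QsAdj n M * QsOp n M)) *ᵥ f) z := by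
  unfold embS
  rw [opD, Matrix.add_mulVec, Matrix.smul_mulVec, Pi.add_apply, Pi.smul_apply, smul_eq_mul]
  have h1 := negLap_embS n M f z
  have h2 := blockAvg_embS n M f z
  unfold embS at h1 h2
  rw [h1, h2]
  push_cast
  ring

end

end Literature.MathematicalPhysics.QuantumFieldTheory.Balaban1983to89.B5GreenBridgeP12Dict
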